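import Summits.ValiantsHypothesis.ValiantsHypothesis.Theorems.ImmanantSliceMonotoneRigidityGadget

/-!
# Route ImmanantSlice — the all-ones-return gadget over an arbitrary coefficient semiring

`ImmanantSliceMonotoneRigidityGadget.lean` proved the projection identity of the all-ones-return
gadget for class functions with values in `ℝ≥0` (crux `MonotoneRigidity`). Its proof is
characteristic-free; this file repeats the substitution and the identity over an ARBITRARY commutative
semiring `K` of coefficients (`gadgetSubstK`, `aeval_gadgetSubstK_slice`), reusing the
`K`-independent permutation combinatorics (`blockPerm`, `gadgetPerm`, `isConj_gadgetPerm`,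
`gadgetPerm_injective`, …) of that file. Consumer: the crux `EvenCycleDominance`
(stmt-ValiantsHypothesis-4211, `K = ℂ`): with `β` a product of 3-cycles the identity reads
`aeval s (D^even_{3r}) = C(W) · per_r` (see the item's evidence note for the class sum `W`).

* `gadgetSubstK K β E fE` — the substitution with constants `0, 1 ∈ K`;
* `aeval_gadgetSubstK_slice` — `aeval (substVCFun (gadgetSubstK K β E fE)) (Σ_σ C(χ σ) Π_i X_(σ i,i))
  = C (Σ_τ χ (gadgetPerm β E fE 1 τ)) · Σ_π Π_i X_(π i, i)` for every class function `χ : S_n → K`.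

Honest framing: bookkeeping for ImmanantSlice; nothing here bears on VP ≠ VNP.

## References
* M. Jerrum, M. Snir, J. ACM 29 (1982), §4.3 (the projection technique). [JerrumSnir1982]
-/

set_option linter.dupNamespace false

noncomputable section

namespace Summit.ValiantsHypothesis.ValiantsHypothesis.Theorems.ImmanantSlice

open MvPolynomial Finset Equiv
open Literature.Computability.AlgebraicComplexity

variable {n r : ℕ}

/-- `f⁻¹ (f x) = x` for permutations. [folklore] -/
private theorem perm_inv_apply_self' {α : Type*} (f : Perm α) (x : α) : f⁻¹ (f x) = x :=
  f.symm_apply_apply x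

/-- `f (f⁻¹ x) = x` for permutations. [folklore] -/
private theorem perm_apply_inv_self' {α : Type*} (f : Perm α) (x : α) : f (f⁻¹ x) = x :=
  f.apply_symm_apply x

/-- The all-ones-return substitution (entry `(x, y)` = arc `y → x`; variables `X_(j,i)` on the arcs
`a_i → β(a_j)`, constant `1` on the arcs `E → A` and `y → β y` off `A ∪ E`, `0` elsewhere).
[folklore] -/
def gadgetSubstK (K : Type*) [CommSemiring K] (β : Perm (Fin n)) (E : Finset (Fin n))
    (fE : Fin r ≃ {x // x ∈ E}) : Fin n × Fin n → (Fin r × Fin r) ⊕ K := fun p =>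
  if h₁ : β⁻¹ p.2 ∈ E then
    (if h₂ : β⁻¹ (β⁻¹ p.1) ∈ E then Sum.inl (fE.symm ⟨_, h₂⟩, fE.symm ⟨_, h₁⟩) else Sum.inr 0)
  else if p.2 ∈ E then (if β⁻¹ p.1 ∈ E then Sum.inr 1 else Sum.inr 0)
  else (if p.1 = β p.2 then Sum.inr 1 else Sum.inr 0)


section GadgetK

variable {K : Type*} [CommSemiring K]
variable (β : Perm (Fin n)) (E : Finset (Fin n)) (fE : Fin r ≃ {x // x ∈ E})
variable {β E}

/-- Values of the substitution on a column `y ∈ A` (`y = a_i`). [folklore] -/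
theorem substVCFun_gadgetSubstK_a (i : Fin r) (x : Fin n) :
    ArithCircuit.substVCFun (gadgetSubstK K β E fE) (x, β (fE i)) =
      if h : β⁻¹ (β⁻¹ x) ∈ E then (X (fE.symm ⟨_, h⟩, i) : MvPolynomial (Fin r × Fin r) K)
      else 0 := by
  unfold ArithCircuit.substVCFun gadgetSubstK
  have h₁ : β⁻¹ (β (fE i)) ∈ E := by rw [perm_inv_apply_self']; exact (fE i).2
  simp only [h₁, dif_pos]
  split_ifs with h₂
  · simp only [Sum.elim_inl]
    congr 2
    rw [Equiv.symm_apply_eq]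
    exact Subtype.ext (perm_inv_apply_self' β _)
  · simp only [Sum.elim_inr, map_zero]

/-- Values of the substitution on a column `y ∉ A ∪ E`. [folklore] -/
theorem substVCFun_gadgetSubstK_of_not_mem {y : Fin n} (hy : y ∉ E) (hy' : β⁻¹ y ∉ E)
    (x : Fin n) :
    ArithCircuit.substVCFun (gadgetSubstK K β E fE) (x, y) =
      if x = β y then (1 : MvPolynomial (Fin r × Fin r) K) else 0 := by
  unfold ArithCircuit.substVCFun gadgetSubstK
  simp only [hy', dif_neg, not_false_eq_true, hy, if_false]
  split_ifs
  · simp only [Sum.elim_inr, map_one]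
  · simp only [Sum.elim_inr, map_zero]



variable (hE : ∀ x ∈ E, β x ∉ E)
include hE

/-- Values of the substitution on a column `y ∈ E` (`y = e_i`). [folklore] -/
theorem substVCFun_gadgetSubstK_fE (i : Fin r) (x : Fin n) :
    ArithCircuit.substVCFun (gadgetSubstK K β E fE) (x, (fE i : Fin n)) =
      if β⁻¹ x ∈ E then (1 : MvPolynomial (Fin r × Fin r) K) else 0 := by
  unfold ArithCircuit.substVCFun gadgetSubstK
  have h₁ : β⁻¹ (fE i : Fin n) ∉ E := inv_apply_not_mem hE (fE i).2
  simp only [h₁, dif_neg, not_false_eq_true, (fE i).2, if_true]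
  split_ifs
  · simp only [Sum.elim_inr, map_one]
  · simp only [Sum.elim_inr, map_zero]

/-- **The weight of a survivor** is the permanent monomial `Π_i X_(π i, i)`. [folklore] -/
theorem prod_substK_gadgetPerm (π τ : Perm (Fin r)) :
    ∏ y : Fin n, ArithCircuit.substVCFun (gadgetSubstK K β E fE) (gadgetPerm β E fE π τ y, y) =
      ∏ i : Fin r, (X (π i, i) : MvPolynomial (Fin r × Fin r) K) := by
  classical
  -- only the columns in `A = β(E)` carry a factor `≠ 1`
  rw [← Finset.prod_subset (Finset.subset_univ (E.map β.toEmbedding))]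
  · -- the `A`-columns, reindexed by `fE`
    have hcol : ∀ i : Fin r, (X (π i, i) : MvPolynomial (Fin r × Fin r) K) =
        ArithCircuit.substVCFun (gadgetSubstK K β E fE)
          (gadgetPerm β E fE π τ (β.toEmbedding (fE i)), β.toEmbedding (fE i)) := by
      intro i
      rw [Equiv.toEmbedding_apply, gadgetPerm_apply_a fE hE, substVCFun_gadgetSubstK_a]
      have h : β⁻¹ (β⁻¹ (β (β (fE (π i) : Fin n)))) ∈ E := by
        rw [perm_inv_apply_self', perm_inv_apply_self']; exact (fE (π i)).2
      rw [dif_pos h]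
      congr 2
      symm
      rw [Equiv.symm_apply_eq]
      refine Subtype.ext ?_
      show β⁻¹ (β⁻¹ (β (β _))) = _
      rw [perm_inv_apply_self', perm_inv_apply_self']
    calc ∏ y ∈ E.map β.toEmbedding, ArithCircuit.substVCFun (gadgetSubstK K β E fE)
            (gadgetPerm β E fE π τ y, y)
        = ∏ x ∈ E, ArithCircuit.substVCFun (gadgetSubstK K β E fE)
            (gadgetPerm β E fE π τ (β.toEmbedding x), β.toEmbedding x) := Finset.prod_map _ _ _
      _ = ∏ x : {x // x ∈ E}, ArithCircuit.substVCFun (gadgetSubstK K β E fE)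
            (gadgetPerm β E fE π τ (β.toEmbedding x), β.toEmbedding x) :=
          (Finset.prod_coe_sort E _).symm
      _ = ∏ i : Fin r, (X (π i, i) : MvPolynomial (Fin r × Fin r) K) :=
          (Fintype.prod_equiv fE _ _ hcol).symm
  · intro y _ hyA
    have hy' : β⁻¹ y ∉ E := by
      intro h
      exact hyA (Finset.mem_map.2 ⟨β⁻¹ y, h, by simp⟩)
    by_cases hyE : y ∈ E
    · have : y = (fE (fE.symm ⟨y, hyE⟩) : Fin n) := by simp
      rw [this, gadgetPerm_apply_fE fE hE, substVCFun_gadgetSubstK_fE fE hE, perm_inv_apply_self',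
        if_pos (fE _).2]
    · rw [gadgetPerm_apply_of_not_mem fE π τ hyE hy',
        substVCFun_gadgetSubstK_of_not_mem fE hyE hy', if_pos rfl]

/-- **Survivors**: a permutation all of whose gadget factors are non-zero is a `gadgetPerm`.
[folklore] -/
theorem exists_eq_gadgetPerm_of_ne_zeroK (σ : Perm (Fin n))
    (h : ∀ y : Fin n, ArithCircuit.substVCFun (gadgetSubstK K β E fE) (σ y, y) ≠
      (0 : MvPolynomial (Fin r × Fin r) K)) :
    ∃ π τ : Perm (Fin r), σ = gadgetPerm β E fE π τ := by
  classical
  -- read `τ` off `E`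
  have hτ : ∀ i : Fin r, β⁻¹ (σ (fE i)) ∈ E := by
    intro i
    have := h (fE i)
    rw [substVCFun_gadgetSubstK_fE fE hE] at this
    by_contra hc
    exact this (if_neg hc)
  -- read `π` off `A`
  have hπ : ∀ i : Fin r, β⁻¹ (β⁻¹ (σ (β (fE i)))) ∈ E := by
    intro i
    have := h (β (fE i))
    rw [substVCFun_gadgetSubstK_a] at this
    by_contra hc
    exact this (dif_neg hc)
  -- the other columns follow `β`
  have hrest : ∀ y : Fin n, y ∉ E → β⁻¹ y ∉ E → σ y = β y := by
    intro y hy hy'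
    have := h y
    rw [substVCFun_gadgetSubstK_of_not_mem fE hy hy'] at this
    by_contra hc
    exact this (if_neg hc)
  let τf : Fin r → Fin r := fun i => fE.symm ⟨_, hτ i⟩
  let πf : Fin r → Fin r := fun i => fE.symm ⟨_, hπ i⟩
  have hτf : ∀ i, (fE (τf i) : Fin n) = β⁻¹ (σ (fE i)) := fun i => by simp [τf]
  have hπf : ∀ i, (fE (πf i) : Fin n) = β⁻¹ (β⁻¹ (σ (β (fE i)))) := fun i => by simp [πf]
  have hτinj : Function.Injective τf := by
    intro i j hij
    have := congrArg (fun k => (fE k : Fin n)) hij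
    simp only [hτf] at this
    exact fE.injective (Subtype.ext (σ.injective (β⁻¹.injective this)))
  have hπinj : Function.Injective πf := by
    intro i j hij
    have := congrArg (fun k => (fE k : Fin n)) hij
    simp only [hπf] at this
    exact fE.injective (Subtype.ext (β.injective (σ.injective
      (β⁻¹.injective (β⁻¹.injective this)))))
  refine ⟨Equiv.ofBijective πf (Finite.injective_iff_bijective.1 hπinj),
    Equiv.ofBijective τf (Finite.injective_iff_bijective.1 hτinj), ?_⟩
  ext y
  by_cases hyA : β⁻¹ y ∈ E
  · -- `y = a_i`
    have hy : y = β (fE (fE.symm ⟨β⁻¹ y, hyA⟩)) := by simp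
    rw [hy, gadgetPerm_apply_a fE hE, Equiv.ofBijective_apply, hπf, perm_apply_inv_self',
      perm_apply_inv_self']
  · by_cases hyE : y ∈ E
    · have hy : y = (fE (fE.symm ⟨y, hyE⟩) : Fin n) := by simp
      rw [hy, gadgetPerm_apply_fE fE hE, Equiv.ofBijective_apply, hτf, perm_apply_inv_self']
    · rw [gadgetPerm_apply_of_not_mem fE _ _ hyE hyA, hrest y hyE hyA]

/-- **The projection identity**: for a class function `χ` on `S_n`,
`aeval (gadget substitution) (Σ_σ χ(σ) Π_i X_(σ i, i)) = C W · per_r` with the class sum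
`W = Σ_τ χ(β ε(τ))` (independent of the `A`-coordinate `π` by `isConj_gadgetPerm`). [folklore] -/
theorem aeval_gadgetSubstK_slice (χ : Perm (Fin n) → K)
    (hχ : ∀ σ τ : Perm (Fin n), IsConj σ τ → χ σ = χ τ) :
    aeval (ArithCircuit.substVCFun (gadgetSubstK K β E fE))
        (∑ σ : Perm (Fin n), C (χ σ) * ∏ i : Fin n, X (σ i, i)) =
      C (∑ τ : Perm (Fin r), χ (gadgetPerm β E fE 1 τ)) *
        ∑ π : Perm (Fin r), ∏ i : Fin r, (X (π i, i) : MvPolynomial (Fin r × Fin r) K) := by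
  classical
  simp only [map_sum, map_mul, aeval_C, map_prod, aeval_X, algebraMap_eq]
  -- the summand vanishes off the image of `gadgetPerm`
  set F : Perm (Fin n) → MvPolynomial (Fin r × Fin r) K := fun σ =>
    C (χ σ) * ∏ y, ArithCircuit.substVCFun (gadgetSubstK K β E fE) (σ y, y) with hF
  set Φ : Perm (Fin r) × Perm (Fin r) → Perm (Fin n) := fun p => gadgetPerm β E fE p.1 p.2 with hΦ
  have hΦinj : Set.InjOn Φ ↑((Finset.univ : Finset (Perm (Fin r))) ×ˢ
      (Finset.univ : Finset (Perm (Fin r)))) := by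
    rintro ⟨π, τ⟩ - ⟨π', τ'⟩ - hpt
    obtain ⟨h1, h2⟩ := gadgetPerm_injective fE hE hpt
    exact Prod.ext h1 h2
  have hsupp : ∀ σ ∈ (Finset.univ : Finset (Perm (Fin n))),
      σ ∉ (Finset.univ ×ˢ Finset.univ).image Φ → F σ = 0 := by
    intro σ _ hσ
    have : ¬ ∀ y : Fin n, ArithCircuit.substVCFun (gadgetSubstK K β E fE) (σ y, y) ≠ 0 := by
      intro hall
      obtain ⟨π, τ, rfl⟩ := exists_eq_gadgetPerm_of_ne_zeroK fE hE σ hall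
      exact hσ (Finset.mem_image.2 ⟨(π, τ), by simp, rfl⟩)
    push Not at this
    obtain ⟨y, hy⟩ := this
    rw [hF]
    simp only
    rw [Finset.prod_eq_zero (Finset.mem_univ y) hy, mul_zero]
  rw [← Finset.sum_subset (Finset.subset_univ _) hsupp, Finset.sum_image hΦinj,
    Finset.sum_product]
  simp only [hF, hΦ, prod_substK_gadgetPerm fE hE]
  rw [Finset.mul_sum]
  refine Finset.sum_congr rfl fun π _ => ?_
  rw [← Finset.sum_mul]
  congr 1
  -- the class sum does not depend on `π`
  calc ∑ τ, C (χ (gadgetPerm β E fE π τ))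
      = ∑ τ, (C (χ (gadgetPerm β E fE 1 (π * τ))) : MvPolynomial (Fin r × Fin r) K) :=
        Finset.sum_congr rfl fun τ _ => by rw [hχ _ _ (isConj_gadgetPerm fE hE π τ)]
    _ = ∑ τ, C (χ (gadgetPerm β E fE 1 τ)) :=
        Fintype.sum_equiv (Equiv.mulLeft π) _ _ fun τ => rfl


end GadgetK

end Summit.ValiantsHypothesis.ValiantsHypothesis.Theorems.ImmanantSlice
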